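/-
Copyright (c) 2026 the pub-hodgecm-mathlib formalisation cell (harness21).  Prover seat hodgecm-mathlib-LH10-p01 (g13): road M6 → F5 → dyadic chain of `stub_DyUnramCore` (D-UNR),
site (L2-3) «THE WALL», row 5 «INTEGRAL-θ» of CENSUS-L23-CM v1 (LH10-p01 (g12)) — the θ-twin of ★ γ₅ `charpoly_coeff_endoEmbLocal_mem_of_shifted`; 2026-09-03.
-/
import Literature.NumberTheory.Rogawski1990.TypeTwoCayleyShiftOrderCM       -- ★ γ₄ (F0P2-p06 (g10)): `mem_integer_iff_valued_le_one`; brings ★ γ₃ (`map_smul_add_smul_one`, `isUnit_localRing_of_ne_zero_of_subsingleton`), γ₂ (carriers: `coe_endoEmbLocal`, `coe_endoGL`, `endoPerm`), γ₁ (`shift_parameter_facts`, `eq_one_add_smul_inv_smul_sub_one`, `forall_valued_inv_smul_sub_one_le_one`), α (`charpoly_coeff_mem_of_forall_mem`)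
import Literature.NumberTheory.Automorphic.TypeTwoHermitianMoebiusShiftFrame   -- ★ P3 p853657 (LH10-p01 (g12)): `hermitianMoebius_one_add_smul_eq`, `forall_valued_hermitianMoebius_le_one`; brings ★ P2 `smul_one_add_smul_add_smul_one_of_add_eq`
import Literature.NumberTheory.Automorphic.MatrixGenMoebiusShift              -- ★ p853671 (LH4-p01 (g12)): `map_genMoebius` (four-scalar transport along a ring map)
import HarnessLib

/-!
# The HERMITIAN-shifted type-(2) pair is integral at `w`: `charpoly(ι(γ_H′)_w) ∈ 𝒪_w[X]` (2-free twin of ★ γ₅)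

Topic `NumberTheory/Rogawski1990`; namespace `Literature.NumberTheory.Rogawski1990`.  THEOREMS ONLY (no definition, no instance, no notation, no named fact, no `sorry`); kernel lane
`--supports stmt-HodgeConjecture-24833`.  Cell `pub/hodgecm-mathlib` (D-0151), crux H413 = `stmt-HodgeConjecture-24833`; road M6 → F5 → the dyadic chain of organ (D-UNR)
`stub_DyUnramCore`, LEVEL TWO, site (L2-3) «THE WALL» = ★ `liftInterior_of_levelTwo` with its `h2 : IsUnit 2` deleted.  Row 5 of CENSUS-L23-CM v1 (LH10-p01 (g12)): the wall's
`hint′` (★ :363) is ★ γ₅ `charpoly_coeff_endoEmbLocal_mem_of_shifted … h2w …` for the σ-FIXED Cayley shift `φ_c`; THIS FILE is its θ-twin for the HERMITIAN shift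
`φ_θ(M) = (θ•M + (c−θ)•1)((c−θ′)•M + θ′•1)⁻¹`, `θ + θ′ = 1`, `θ` integral (`θ′ = σθ` is not even needed here), at ANY residue characteristic.

THE MATHEMATICS (★ γ₅'s proof with the θ-heads of ★ P3 substituted).  `ι(γ_H′)_w = reindex endoPerm (g′_w ⊕ u′_w)` with `g_w = 1 + c_w X₂`, `X₂ = c_w⁻¹(g_w − 1)` entrywise integral
(deepness `g_w ≡ 1 (mod c_w)`), `g′_w = φ_θ(g_w) = (1 + θ_w X₂)(1 + (c_w − θ′_w)X₂)⁻¹` (★ P3 `hermitianMoebius_one_add_smul_eq`: both sides of `φ_θ` at `1 + c•X` are `c` times a cofactor)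
is entrywise integral when `|det(1 + (c_w − θ′_w)X₂)| = 1` (★ P3 `forall_valued_hermitianMoebius_le_one`), and `|u′_w| = |θu + (c−θ)|_w ∕ |(c−θ′)u + θ′|_w = 1`; an entrywise-integral
matrix has characteristic polynomial over `𝒪_w` (★ α `charpoly_coeff_mem_of_forall_mem`).  BINDERS: instead of re-deriving the denominators' `w`-valuations from the discriminant
depth `hN` and unitarity (as ★ γ₅ does through ★ γ₃ `isUnit_shift_denominators_of_typeTwo … h2`), this twin TAKES them — `hw2m : |det((c−θ′)•g + θ′•1)|_w = exp(−2)`,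
`hw1m : |(c−θ′)u + θ′|_w = exp(−1)`, `hw1p : |θu + (c−θ)|_w = exp(−1)` — which are conjuncts 1∕3∕4 of the θ-twin of ★ γ₃ («BINDERS-θ TYPE (2)», LH7-p04 (g13)) and are
ALREADY in scope at the wall's call site (★ :354–:355 `obtain ⟨hw2m, -, hw1m, -, …⟩`), so the port threads them by name; `|det(1 + (c_w − θ′_w)X₂)| = 1` is read off `hw2m`
(`det((c−θ′)•g + θ′•1) = c² · det(1 + (c−θ′)X₂)`, ★ P2 `smul_one_add_smul_add_smul_one_of_add_eq`).  The integers are the `ValuativeRel` integers `𝒪[L_w]` (★ γ₅'s and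
the wall's currency; bridge ★ γ₄ `mem_integer_iff_valued_le_one`).  Count-neutral CM glue; nothing printed is asserted.
HONEST LABEL: L2-3 remains THE WALL at the CM-glue layer until every row of CENSUS-L23-CM is paid and `stub_liftInterior_dy` lands; HC_CM is proved only modulo the 7 printed
citations (2 remaining: hLiu418 = stmt-HodgeConjecture-24832, h413 = stmt-HodgeConjecture-24833) until rung 0 closes.

## References
* [Kottwitz1986BaseChangeUnits] R. E. Kottwitz, *Base change for unit elements of Hecke algebras*, Compositio Math. 60 (1986): §2 pp. 244–247.
* [Rogawski1990] J. D. Rogawski, *Automorphic Representations of Unitary Groups in Three Variables*, Ann. of Math. Stud. 123 (1990): §4.9 Prop. 4.9.1 (b) p. 55.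
-/

set_option autoImplicit false

noncomputable section

open NumberField IsDedekindDomain Matrix Polynomial
open scoped MatrixGroups WithZero ValuativeRel

namespace Literature.NumberTheory.Rogawski1990

open Literature.NumberTheory.Automorphic Literature.NumberTheory.Automorphic.UnitaryGroup Literature.NumberTheory.Automorphic.MoebiusShift
open Literature.NumberTheory.GaloisRepresentations Literature.NumberTheory.NumberFields

variable (L : Type) [Field L] [NumberField L] [IsCMField L] (v : HeightOneSpectrum (𝓞 ↥(maximalRealSubfield L)))
  (w : PlacesOver L v) (hw : IsCMField.complexConj L • w.1 = w.1)

include hw in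
set_option maxHeartbeats 1600000 in
-- the carriers' types are large (same budget as ★ γ₅)
/-- **«INTEGRAL-θ» — `hint′` for the hermitian shift** (θ-twin of ★ γ₅ `charpoly_coeff_endoEmbLocal_mem_of_shifted`): at a non-split place (`σ • w = w`), for `|c_w| = exp(−1)`,
`θ + θ′ = 1`, `|θ_w| ≤ 1`, a type-(2) `γ_H = (g, u)` with `g_w ≡ 1 (mod c_w)` entrywise, and `γ_H′` on the carriers with `g′ = φ_θ(g) = (θ•g + (c−θ)•1)((c−θ′)•g + θ′•1)⁻¹`,
`u′ = (θu + (c−θ))·((c−θ′)u + θ′)⁻¹`, given the denominators' `w`-valuations `|det((c−θ′)•g + θ′•1)|_w = exp(−2)`, `|(c−θ′)u + θ′|_w = |θu + (c−θ)|_w = exp(−1)`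
(conjuncts 1∕3∕4 of «BINDERS-θ TYPE (2)»): every coefficient of `charpoly(ι(γ_H′)_w)` lies in `𝒪_w`.  No `|2|_w = 1`.
[cite: Kottwitz1986BaseChangeUnits, §2 pp. 244–247] [cite: Rogawski1990, §4.9 Prop. 4.9.1 (b) p. 55] -/
theorem charpoly_coeff_endoEmbLocal_mem_of_hermitianShifted
    (γH γH' : (cmDatum L 2 (Matrix.of fun i j : Fin 2 => if i.val + j.val + 1 = 2 then (1 : L) else 0)).Local v ×
      (cmDatum L 1 (Matrix.of fun i j : Fin 1 => if i.val + j.val + 1 = 1 then (1 : L) else 0)).Local v)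
    {c θ θ' : LocalRing L v} (hc : Valued.v (c w) = WithZero.exp (-1 : ℤ)) (hθ : θ + θ' = 1) (hθv : Valued.v (θ w) ≤ 1)
    (h1 : ((γH'.1.val : GL (Fin 2) (LocalRing L v)).val : Matrix (Fin 2) (Fin 2) (LocalRing L v)) =
      (θ • ((γH.1.val : GL (Fin 2) (LocalRing L v)).val : Matrix (Fin 2) (Fin 2) (LocalRing L v)) + (c - θ) • 1) *
        ((c - θ') • ((γH.1.val : GL (Fin 2) (LocalRing L v)).val : Matrix (Fin 2) (Fin 2) (LocalRing L v)) + θ' • 1)⁻¹)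
    (hu' : finGammaTwo L v γH' = (θ * finGammaTwo L v γH + (c - θ)) * Ring.inverse ((c - θ') * finGammaTwo L v γH + θ'))
    (hg1 : ∀ i j, Valued.v ((((γH.1.val : GL (Fin 2) (LocalRing L v)).val.map (Pi.evalRingHom (fun w' : PlacesOver L v => w'.1.adicCompletion L) w)) - 1) i j) ≤ Valued.v (c w))
    (hw2m : Valued.v ((((c - θ') • ((γH.1.val : GL (Fin 2) (LocalRing L v)).val : Matrix (Fin 2) (Fin 2) (LocalRing L v)) + θ' • (1 : Matrix (Fin 2) (Fin 2) (LocalRing L v))).det) w) =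
      WithZero.exp (-2 : ℤ))
    (hw1m : Valued.v (((c - θ') * finGammaTwo L v γH + θ') w) = WithZero.exp (-1 : ℤ))
    (hw1p : Valued.v ((θ * finGammaTwo L v γH + (c - θ)) w) = WithZero.exp (-1 : ℤ)) :
    ∀ i : ℕ, ((((endoEmbLocal L v γH').val : GL (Fin 3) (LocalRing L v)).val.map
        (Pi.evalRingHom (fun w' : PlacesOver L v => w'.1.adicCompletion L) w)).charpoly.coeff i) ∈ 𝒪[w.1.adicCompletion L] := by
  have hv : Subsingleton (PlacesOver L v) := PlacesOver.subsingleton_of_smul_eq (IsCMField.complexConj L) (IsCMField.complexConj_ne_one L) w hw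
  set evw : LocalRing L v →+* w.1.adicCompletion L := Pi.evalRingHom (fun w' : PlacesOver L v => w'.1.adicCompletion L) w with hevw
  set O : Subring (w.1.adicCompletion L) := 𝒪[w.1.adicCompletion L] with hOdef
  have hO : ∀ {z : w.1.adicCompletion L}, z ∈ O ↔ Valued.v z ≤ 1 := fun {z} => mem_integer_iff_valued_le_one L v w z
  set gw : Matrix (Fin 2) (Fin 2) (w.1.adicCompletion L) := ((γH.1.val : GL (Fin 2) (LocalRing L v)).val.map evw) with hgw
  set uw : w.1.adicCompletion L := finGammaTwo L v γH w with huw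
  set cw : w.1.adicCompletion L := c w with hcw
  set θw : w.1.adicCompletion L := θ w with hθwdef
  set θ'w : w.1.adicCompletion L := θ' w with hθ'wdef
  obtain ⟨hc0, hc1, -, -, -, -⟩ := shift_parameter_facts hc
  -- the scalars at `w`: `θ_w + θ′_w = 1`, so `θ′_w` and `c_w − θ′_w` are integral
  have hθw : θw + θ'w = 1 := congrFun hθ w
  have hθ'v : Valued.v θ'w ≤ 1 := by
    rw [show θ'w = 1 - θw by rw [← hθw]; ring]
    exact (Valuation.map_sub _ _ _).trans (max_le (le_of_eq (Valuation.map_one _)) hθv)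
  have htv : Valued.v (cw - θ'w) ≤ 1 := (Valuation.map_sub _ _ _).trans (max_le hc1.le hθ'v)
  -- the `E_v`-level denominators are units (one place above `v`)
  have hne : ∀ {x : LocalRing L v} {z : ℤ}, Valued.v (x w) = WithZero.exp z → IsUnit x := fun {x z} hx =>
    isUnit_localRing_of_ne_zero_of_subsingleton L v hv fun h0 => by rw [h0, Pi.zero_apply, map_zero] at hx; exact WithZero.zero_ne_coe hx
  have hU2m : IsUnit (((c - θ') • ((γH.1.val : GL (Fin 2) (LocalRing L v)).val : Matrix (Fin 2) (Fin 2) (LocalRing L v)) + θ' • (1 : Matrix (Fin 2) (Fin 2) (LocalRing L v))).det) :=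
    hne hw2m
  have hU1m : IsUnit ((c - θ') * finGammaTwo L v γH + θ') := hne hw1m
  -- `g_w = 1 + c_w X₂` with `X₂` integral, and `|det(1 + (c_w − θ′_w)X₂)| = 1` read off `hw2m`
  set X₂ : Matrix (Fin 2) (Fin 2) (w.1.adicCompletion L) := cw⁻¹ • (gw - 1) with hX₂
  have hgX : gw = 1 + cw • X₂ := eq_one_add_smul_inv_smul_sub_one hc0 gw
  have hX₂i : ∀ i j, Valued.v (X₂ i j) ≤ 1 := forall_valued_inv_smul_sub_one_le_one hc0 hg1
  have hdet2w : ∀ a b : LocalRing L v, ((a • ((γH.1.val : GL (Fin 2) (LocalRing L v)).val : Matrix (Fin 2) (Fin 2) (LocalRing L v)) + b • (1 : Matrix (Fin 2) (Fin 2) (LocalRing L v))).det) w =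
      (a w • gw + b w • (1 : Matrix (Fin 2) (Fin 2) (w.1.adicCompletion L))).det := fun a b => by
    have e1 : ((a • ((γH.1.val : GL (Fin 2) (LocalRing L v)).val : Matrix (Fin 2) (Fin 2) (LocalRing L v)) + b • (1 : Matrix (Fin 2) (Fin 2) (LocalRing L v))).det) w =
        evw ((a • ((γH.1.val : GL (Fin 2) (LocalRing L v)).val : Matrix (Fin 2) (Fin 2) (LocalRing L v)) + b • (1 : Matrix (Fin 2) (Fin 2) (LocalRing L v))).det) := rfl
    rw [e1, RingHom.map_det, RingHom.mapMatrix_apply, map_smul_add_smul_one]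
    rfl
  have hvm2 : Valued.v (((1 : Matrix (Fin 2) (Fin 2) (w.1.adicCompletion L)) + (cw - θ'w) • X₂).det) = 1 := by
    have e := hdet2w (c - θ') θ'
    rw [show (c - θ') w = cw - θ'w from rfl, show θ' w = θ'w from rfl, hgX, smul_one_add_smul_add_smul_one_of_add_eq X₂ cw (cw - θ'w) θ'w (by ring),
      Matrix.det_smul, Fintype.card_fin] at e
    have h := hw2m
    rw [e, map_mul, map_pow, hc, ← WithZero.exp_nsmul] at h
    have hne' : WithZero.exp ((2 : ℕ) • (-1 : ℤ)) ≠ 0 := WithZero.exp_ne_zero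
    have h' := (eq_inv_mul_iff_mul_eq₀ hne').2 h
    rw [h', ← WithZero.exp_neg, ← WithZero.exp_add, ← WithZero.exp_zero, WithZero.exp_inj]
    simp
  have hNu : IsUnit (((1 : Matrix (Fin 2) (Fin 2) (w.1.adicCompletion L)) + (cw - θ'w) • X₂).det) :=
    isUnit_iff_ne_zero.2 fun h0 => by rw [h0, map_zero] at hvm2; exact zero_ne_one hvm2
  -- `g′_w = (1 + θ_w X₂)(1 + (c_w − θ′_w)X₂)⁻¹` is integral (★ P3)
  have hg'w : ((γH'.1.val : GL (Fin 2) (LocalRing L v)).val.map evw) =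
      ((1 : Matrix (Fin 2) (Fin 2) (w.1.adicCompletion L)) + θw • X₂) * ((1 : Matrix (Fin 2) (Fin 2) (w.1.adicCompletion L)) + (cw - θ'w) • X₂)⁻¹ := by
    rw [h1, map_genMoebius evw _ _ _ _ _ hU2m, map_sub, map_sub]
    change (θw • gw + (cw - θw) • (1 : Matrix (Fin 2) (Fin 2) (w.1.adicCompletion L))) * ((cw - θ'w) • gw + θ'w • 1)⁻¹ = _
    rw [hgX]; exact hermitianMoebius_one_add_smul_eq X₂ hc0 θw θ'w hNu
  have hg'i : ∀ i j, Valued.v (((γH'.1.val : GL (Fin 2) (LocalRing L v)).val.map evw) i j) ≤ 1 := by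
    rw [hg'w]; exact forall_valued_hermitianMoebius_le_one hθv htv hX₂i hvm2
  -- `u′_w` is a unit
  have huw' : finGammaTwo L v γH' w = (θw * uw + (cw - θw)) / ((cw - θ'w) * uw + θ'w) := by
    have hmul : finGammaTwo L v γH' * ((c - θ') * finGammaTwo L v γH + θ') = θ * finGammaTwo L v γH + (c - θ) := by
      rw [hu', mul_assoc, Ring.inverse_mul_cancel _ hU1m, mul_one]
    have hmw := congrFun hmul w
    simp only [Pi.mul_apply, Pi.add_apply, Pi.sub_apply] at hmw
    have hne' : (cw - θ'w) * uw + θ'w ≠ 0 := fun h => by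
      have e : ((c - θ') * finGammaTwo L v γH + θ') w = (cw - θ'w) * uw + θ'w := rfl
      rw [e, h, map_zero] at hw1m; exact WithZero.zero_ne_coe hw1m
    rw [eq_div_iff hne']
    exact hmw
  have hw1m' : Valued.v ((cw - θ'w) * uw + θ'w) = WithZero.exp (-1 : ℤ) := hw1m
  have hw1p' : Valued.v (θw * uw + (cw - θw)) = WithZero.exp (-1 : ℤ) := hw1p
  have hu'1 : Valued.v (finGammaTwo L v γH' w) = 1 := by
    rw [huw', map_div₀, hw1m', hw1p', div_self (WithZero.exp_ne_zero (a := (-1 : ℤ)))]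
  have hu'i : Valued.v (finGammaTwo L v γH' w) ≤ 1 := hu'1.le
  -- the block matrix `ι(γ_H′)_w` is entrywise integral
  have hι : (((endoEmbLocal L v γH').val : GL (Fin 3) (LocalRing L v)).val.map evw) =
      Matrix.reindex endoPerm endoPerm (Matrix.fromBlocks (((γH'.1.val : GL (Fin 2) (LocalRing L v)).val.map evw)) 0 0 (((γH'.2.val : GL (Fin 1) (LocalRing L v)).val.map evw))) := by
    rw [coe_endoEmbLocal, coe_endoGL, Matrix.reindex_apply, ← Matrix.submatrix_map, Matrix.fromBlocks_map]
    simp [Matrix.reindex_apply]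
  have hU'00 : (((γH'.2.val : GL (Fin 1) (LocalRing L v)).val.map evw)) 0 0 = finGammaTwo L v γH' w := rfl
  have hent : ∀ i j, ((((endoEmbLocal L v γH').val : GL (Fin 3) (LocalRing L v)).val.map evw) i j) ∈ O := by
    intro i j
    rw [hι, Matrix.reindex_apply, Matrix.submatrix_apply]
    refine hO.2 ?_
    rcases endoPerm.symm i with a | a <;> rcases endoPerm.symm j with b | b
    · rw [Matrix.fromBlocks_apply₁₁]; exact hg'i a b
    · rw [Matrix.fromBlocks_apply₁₂, Matrix.zero_apply, map_zero]; exact zero_le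
    · rw [Matrix.fromBlocks_apply₂₁, Matrix.zero_apply, map_zero]; exact zero_le
    · obtain rfl : a = 0 := Subsingleton.elim _ _
      obtain rfl : b = 0 := Subsingleton.elim _ _
      rw [Matrix.fromBlocks_apply₂₂, hU'00]; exact hu'i
  intro i
  exact charpoly_coeff_mem_of_forall_mem O hent i

end Literature.NumberTheory.Rogawski1990

end
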